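import Summits.CriticalPhenomena.PercolationContinuityZ3.Theorems.PercNearOneGluingNoHeavyLowerTailM3Labeling
import Literature.Probability.Percolation.PercolationEvents
import HarnessLib

/-!
# `NoHeavyLowerTail` (stmt-CriticalPhenomena-4575) — the three-point connection pattern of bond percolation
# (optionally on a quotient graph) is a monotone `M₃`-labeling; Gladkov's AG and the hybrid rows for it

Support file (prover prim-ineq-prove-2 gen 3, `--supports stmt-CriticalPhenomena-4575`; companion of
`…M3Labeling`).  No named facts, no sorries.
-/

noncomputable section

namespace Summit.CriticalPhenomena.PercolationContinuityZ3.Theorems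

open MeasureTheory Literature.Probability.LatticeModels Literature.Probability.Percolation

/-! ### The three-point connection pattern of bond percolation is a monotone `M3`-labeling -/

section Perc

variable {V : Type*}

open Classical in
/-- The connection pattern of `(a, b, c)` in the configuration `ω`: `top` = all joined,
`pet 0` = `ab|c`, `pet 1` = `ac|b`, `pet 2` = `a|bc`, `bot` = `a|b|c`. [folklore] -/
def pattern (a b c : V) (ω : BondConfig V) : M3 :=
  if ω ∈ openConn a b then (if ω ∈ openConn a c then .top else .pet 0)
  else if ω ∈ openConn a c then .pet 1 else if ω ∈ openConn b c then .pet 2 else .bot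

/-- Pattern `top`: both `a↔b` and `a↔c`. [folklore] -/
theorem pattern_of_ab_ac {a b c : V} {ω : BondConfig V} (h1 : ω ∈ openConn a b) (h2 : ω ∈ openConn a c) :
    pattern a b c ω = .top := by unfold pattern; rw [if_pos h1, if_pos h2]
/-- Pattern `ab|c`. [folklore] -/
theorem pattern_of_ab_nac {a b c : V} {ω : BondConfig V} (h1 : ω ∈ openConn a b) (h2 : ω ∉ openConn a c) :
    pattern a b c ω = .pet 0 := by unfold pattern; rw [if_pos h1, if_neg h2]
/-- Pattern `ac|b`. [folklore] -/
theorem pattern_of_nab_ac {a b c : V} {ω : BondConfig V} (h1 : ω ∉ openConn a b) (h2 : ω ∈ openConn a c) :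
    pattern a b c ω = .pet 1 := by unfold pattern; rw [if_neg h1, if_pos h2]
/-- Pattern `a|bc`. [folklore] -/
theorem pattern_of_nab_nac_bc {a b c : V} {ω : BondConfig V} (h1 : ω ∉ openConn a b)
    (h2 : ω ∉ openConn a c) (h3 : ω ∈ openConn b c) : pattern a b c ω = .pet 2 := by
  unfold pattern; rw [if_neg h1, if_neg h2, if_pos h3]
/-- Pattern `a|b|c`. [folklore] -/
theorem pattern_of_none {a b c : V} {ω : BondConfig V} (h1 : ω ∉ openConn a b)
    (h2 : ω ∉ openConn a c) (h3 : ω ∉ openConn b c) : pattern a b c ω = .bot := by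
  unfold pattern; rw [if_neg h1, if_neg h2, if_neg h3]

/-- The pattern labeling is monotone (more open edges ⇒ coarser pattern; transitivity of `↔`). -/
theorem pattern_mono (a b c : V) : Monotone (pattern a b c) := by
  intro ω ω' hle
  have mab := isUpperSet_openConn (V := V) a b hle
  have mac := isUpperSet_openConn (V := V) a c hle
  have mbc := isUpperSet_openConn (V := V) b c hle
  have tr1 : ω' ∈ openConn a b → ω' ∈ openConn b c → ω' ∈ openConn a c :=
    fun h1 h2 => SimpleGraph.Reachable.trans h1 h2
  have tr2 : ω' ∈ openConn a c → ω' ∈ openConn b c → ω' ∈ openConn a b :=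
    fun h1 h2 => SimpleGraph.Reachable.trans h1 (SimpleGraph.Reachable.symm h2)
  by_cases h1 : ω ∈ openConn a b
  · by_cases h2 : ω ∈ openConn a c
    · rw [pattern_of_ab_ac h1 h2, pattern_of_ab_ac (mab h1) (mac h2)]
    · rw [pattern_of_ab_nac h1 h2]
      by_cases h2' : ω' ∈ openConn a c
      · rw [pattern_of_ab_ac (mab h1) h2']; exact M3.le_top _
      · rw [pattern_of_ab_nac (mab h1) h2']
  · by_cases h2 : ω ∈ openConn a c
    · rw [pattern_of_nab_ac h1 h2]
      by_cases h1' : ω' ∈ openConn a b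
      · rw [pattern_of_ab_ac h1' (mac h2)]; exact M3.le_top _
      · rw [pattern_of_nab_ac h1' (mac h2)]
    · by_cases h3 : ω ∈ openConn b c
      · rw [pattern_of_nab_nac_bc h1 h2 h3]
        by_cases h1' : ω' ∈ openConn a b
        · rw [pattern_of_ab_ac h1' (tr1 h1' (mbc h3))]; exact M3.le_top _
        · have h2' : ω' ∉ openConn a c := fun h => h1' (tr2 h (mbc h3))
          rw [pattern_of_nab_nac_bc h1' h2' (mbc h3)]
      · rw [pattern_of_none h1 h2 h3]; exact M3.bot_le _

/-- The pattern is determined by all edges (finite edge type). [folklore] -/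
theorem pattern_detBy [Fintype (Sym2 V)] (a b c : V) :
    LDetBy (pattern a b c) ↑(Finset.univ : Finset (Sym2 V)) := by
  intro ω ω' h; simp only [Finset.coe_univ, Set.inter_univ] at h; rw [h]

/-- `{pattern = top} = {a↔b} ∩ {a↔c}`. [folklore] -/
theorem pattern_top (a b c : V) : pattern a b c ⁻¹' {M3.top} = openConn a b ∩ openConn a c := by
  ext ω
  simp only [Set.mem_preimage, Set.mem_singleton_iff, Set.mem_inter_iff]
  by_cases h1 : ω ∈ openConn a b <;> by_cases h2 : ω ∈ openConn a c
  · simp [pattern_of_ab_ac h1 h2, h1, h2]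
  · simp [pattern_of_ab_nac h1 h2, h2]
  · simp [pattern_of_nab_ac h1 h2, h1]
  · by_cases h3 : ω ∈ openConn b c
    · simp [pattern_of_nab_nac_bc h1 h2 h3, h1]
    · simp [pattern_of_none h1 h2 h3, h1]

/-- `{pattern = ab|c} = {a↔b} ∖ {a↔c}`. [folklore] -/
theorem pattern_pet0 (a b c : V) : pattern a b c ⁻¹' {M3.pet 0} = openConn a b ∩ (openConn a c)ᶜ := by
  ext ω
  simp only [Set.mem_preimage, Set.mem_singleton_iff, Set.mem_inter_iff, Set.mem_compl_iff]
  by_cases h1 : ω ∈ openConn a b <;> by_cases h2 : ω ∈ openConn a c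
  · simp [pattern_of_ab_ac h1 h2, h2]
  · simp [pattern_of_ab_nac h1 h2, h1, h2]
  · simp [pattern_of_nab_ac h1 h2, h1]
  · by_cases h3 : ω ∈ openConn b c
    · simp [pattern_of_nab_nac_bc h1 h2 h3, h1]
    · simp [pattern_of_none h1 h2 h3, h1]

/-- `{pattern = ac|b} = {a↔c} ∖ {a↔b}`. [folklore] -/
theorem pattern_pet1 (a b c : V) : pattern a b c ⁻¹' {M3.pet 1} = openConn a c ∩ (openConn a b)ᶜ := by
  ext ω
  simp only [Set.mem_preimage, Set.mem_singleton_iff, Set.mem_inter_iff, Set.mem_compl_iff]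
  by_cases h1 : ω ∈ openConn a b <;> by_cases h2 : ω ∈ openConn a c
  · simp [pattern_of_ab_ac h1 h2, h1]
  · simp [pattern_of_ab_nac h1 h2, h2]
  · simp [pattern_of_nab_ac h1 h2, h1, h2]
  · by_cases h3 : ω ∈ openConn b c
    · simp [pattern_of_nab_nac_bc h1 h2 h3, h2]
    · simp [pattern_of_none h1 h2 h3, h2]

/-- `{pattern = a|bc} = {b↔c} ∖ {a↔b}` (transitivity excludes `a↔c`). [folklore] -/
theorem pattern_pet2 (a b c : V) : pattern a b c ⁻¹' {M3.pet 2} = openConn b c ∩ (openConn a b)ᶜ := by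
  ext ω
  simp only [Set.mem_preimage, Set.mem_singleton_iff, Set.mem_inter_iff, Set.mem_compl_iff]
  have tr2 : ω ∈ openConn a c → ω ∈ openConn b c → ω ∈ openConn a b :=
    fun h1 h2 => SimpleGraph.Reachable.trans h1 (SimpleGraph.Reachable.symm h2)
  by_cases h1 : ω ∈ openConn a b <;> by_cases h2 : ω ∈ openConn a c
  · simp [pattern_of_ab_ac h1 h2, h1]
  · simp [pattern_of_ab_nac h1 h2, h1]
  · simp [pattern_of_nab_ac h1 h2, h1]; exact fun h => h1 (tr2 h2 h)
  · by_cases h3 : ω ∈ openConn b c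
    · simp [pattern_of_nab_nac_bc h1 h2 h3, h1, h3]
    · simp [pattern_of_none h1 h2 h3, h3]

/-- `{pattern = bot} = {a↮b} ∩ {a↮c} ∩ {b↮c}`. [folklore] -/
theorem pattern_bot (a b c : V) :
    pattern a b c ⁻¹' {M3.bot} = (openConn a b)ᶜ ∩ (openConn a c)ᶜ ∩ (openConn b c)ᶜ := by
  ext ω
  simp only [Set.mem_preimage, Set.mem_singleton_iff, Set.mem_inter_iff, Set.mem_compl_iff]
  by_cases h1 : ω ∈ openConn a b <;> by_cases h2 : ω ∈ openConn a c
  · simp [pattern_of_ab_ac h1 h2, h1]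
  · simp [pattern_of_ab_nac h1 h2, h1]
  · simp [pattern_of_nab_ac h1 h2, h2]
  · by_cases h3 : ω ∈ openConn b c
    · simp [pattern_of_nab_nac_bc h1 h2 h3, h3]
    · simp [pattern_of_none h1 h2 h3, h1, h2, h3]


/-! ### Quotient (glued) patterns and the general AG / hybrid rows for percolation -/

/-- The connection pattern of `(a, b, c)` after forcing the edges of `K` open (pattern on the quotient
graph that glues along `K`). [folklore] -/
def patternK (a b c : V) (K : Set (Sym2 V)) (ω : BondConfig V) : M3 := pattern a b c (ω ∪ K)

/-- The glued pattern is monotone. [folklore] -/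
theorem patternK_mono (a b c : V) (K : Set (Sym2 V)) : Monotone (patternK a b c K) :=
  fun _ _ h => pattern_mono a b c (Set.union_subset_union_left K h)

/-- The glued pattern is determined by all edges (finite edge type). [folklore] -/
theorem patternK_detBy [Fintype (Sym2 V)] (a b c : V) (K : Set (Sym2 V)) :
    LDetBy (patternK a b c K) ↑(Finset.univ : Finset (Sym2 V)) := by
  intro ω ω' h; simp only [Finset.coe_univ, Set.inter_univ] at h; rw [h]

/-- **Gladkov's AG for every glued three-point law.**  For `μ = prodBernoulli w` on a finite edge type,
vertices `a, b, c` and any set `K` of forced-open edges, the five cells of the pattern of `(a,b,c)` in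
`ω ∪ K` satisfy `c₀c₁ + c₀c₂ + c₁c₂ ≤ a·b` (cells as `cell w (patternK a b c K)`).  `K = ∅` is
[Gladkov2024StrongFKG, Cor. 4.2] (`prodBernoulli_threePoint_strongHarris`); general `K` covers every
quotient ("group") three-point law used as an LP row by the factory.
[cite: Gladkov2024StrongFKG, Thm. 2.1 / Cor. 4.2 — corollary] -/
theorem patternK_AG [Fintype (Sym2 V)] (w : Sym2 V → unitInterval) (a b c : V) (K : Set (Sym2 V)) :
    cell w (patternK a b c K) (.pet 0) * cell w (patternK a b c K) (.pet 1) +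
        cell w (patternK a b c K) (.pet 0) * cell w (patternK a b c K) (.pet 2) +
        cell w (patternK a b c K) (.pet 1) * cell w (patternK a b c K) (.pet 2) ≤
      cell w (patternK a b c K) .top * cell w (patternK a b c K) .bot := by
  classical
  exact cell_AG w (patternK_mono a b c K) (patternK_detBy a b c K)

/-- **Hybrid rows are theorems (AG shape).**  For an edge `e`, a set `K` of forced-open edges and ANY map
`Φ : M3 → M3 → M3` monotone on the pairs `α ≤ β` (`HybMono Φ`, 6 785 maps), the labeling
`ω ↦ Φ(pattern(ω ∖ e ∪ K), pattern(ω ∪ e ∪ K))` satisfies Gladkov's AG: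
`c₀c₁ + c₀c₂ + c₁c₂ ≤ a·b` for its cells, which are the sums `Σ_{Φ(α,β)=x} z_(α,β)` of the 12 section atoms
(`cell_hyb`).  These are the quadratic "hybrid rows" of the memo (valid 4-point rows of the terminal-edge
algebra; pulled back to the law of `(a,b,c,y)` they are Gladkov rows of up-set sunflowers of `Π₄`).
[cite: Gladkov2024StrongFKG, Thm. 2.1 — corollary] -/
theorem hybrid_AG [Fintype (Sym2 V)] [DecidableEq (Sym2 V)] (w : Sym2 V → unitInterval) (a b c : V)
    (K : Set (Sym2 V)) (e : Sym2 V) {Φ : M3 → M3 → M3} (hΦ : HybMono Φ) :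
    cell w (hyb Φ (patternK a b c K) e) (.pet 0) * cell w (hyb Φ (patternK a b c K) e) (.pet 1) +
        cell w (hyb Φ (patternK a b c K) e) (.pet 0) * cell w (hyb Φ (patternK a b c K) e) (.pet 2) +
        cell w (hyb Φ (patternK a b c K) e) (.pet 1) * cell w (hyb Φ (patternK a b c K) e) (.pet 2) ≤
      cell w (hyb Φ (patternK a b c K) e) .top * cell w (hyb Φ (patternK a b c K) e) .bot := by
  classical
  have hdet : LDetBy (patternK a b c K) ↑(insert e ((Finset.univ : Finset (Sym2 V)).erase e)) := by
    rw [Finset.insert_erase (Finset.mem_univ e)]; exact patternK_detBy a b c K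
  exact cell_AG w (hyb_mono hΦ (patternK_mono a b c K) e) (hyb_detBy Φ hdet)

/-- **The five cells of the ungIued pattern are the five three-point events of the tree** (`K = ∅`):
`t = μ(ab ∩ ac)`, `u_ab = μ(ab ∖ ac)`, `u_ac = μ(ac ∖ ab)`, `u_bc = μ(bc ∖ ab)`, `q = μ(abᶜ ∩ acᶜ ∩ bcᶜ)`. [folklore] -/
theorem cell_pattern_eq (w : Sym2 V → unitInterval) (a b c : V) :
    cell w (pattern a b c) .top = (prodBernoulli w).real (openConn a b ∩ openConn a c) ∧
    cell w (pattern a b c) (.pet 0) = (prodBernoulli w).real (openConn a b ∩ (openConn a c)ᶜ) ∧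
    cell w (pattern a b c) (.pet 1) = (prodBernoulli w).real (openConn a c ∩ (openConn a b)ᶜ) ∧
    cell w (pattern a b c) (.pet 2) = (prodBernoulli w).real (openConn b c ∩ (openConn a b)ᶜ) ∧
    cell w (pattern a b c) .bot =
      (prodBernoulli w).real ((openConn a b)ᶜ ∩ (openConn a c)ᶜ ∩ (openConn b c)ᶜ) := by
  simp only [cell, pattern_top, pattern_pet0, pattern_pet1, pattern_pet2, pattern_bot, and_self]

end Perc

end Summit.CriticalPhenomena.PercolationContinuityZ3.Theorems
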